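import Mathlib
import Literature.Analysis.FluidPDE.SelfSimilarLiouville
import Literature.Analysis.FluidPDE.NecasRuzickaSverakHolds
import Literature.Analysis.FluidPDE.TsaiSelfSimilarHolds
import Literature.Analysis.FluidPDE.TsaiLocalEnergyHolds
import Literature.Analysis.FluidPDE.TsaiSelfSimilarBounded
import Literature.Analysis.FluidPDE.ChaeWolfRemovingDSS
import Literature.Analysis.FluidPDE.ChaeWolfRemovingDSSProofs
import Literature.Analysis.FluidPDE.AncientAxisymmetricTypeILiouville
import Literature.Analysis.FluidPDE.LocalTypeI
import Literature.Analysis.FluidPDE.ChaeAsymptoticallySelfSimilarProofs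
import Literature.Analysis.FluidPDE.ChaeAsymptoticallySelfSimilarProfileSubcritical
import Literature.Analysis.FluidPDE.ChaeAsymptoticallySelfSimilarLocalLeray
import Literature.Analysis.FluidPDE.SereginSverak2002VertexBlowupLimit
import Literature.Barriers.NavierStokesRegularity.NearOneDssTypeIExclusion
import Summits.NavierStokesRegularity.NavierStokesRegularity.Theorems.TypeIDSSLiouvilleConjecture
import HarnessLib.Audit
import HarnessLib

/-!
# Blow-up scenario census — block D: backward SELF-SIMILAR (Leray) and λ-DSS profiles (R = 1)

Cell `pub/ns-census` (director-ns KEY req102, 2026-08-28; D-0154 (A)).  Typed companion of block D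
(rows D1–D11) of the lead's `SCENARIO-CENSUS.md` v1.1 (seat ns-census-lead g2; keys fixed there).
Per row: `Row_<key> : Prop` — the exact exclusion / Liouville statement of the cell over tree
predicates (OPEN rows are `@[conjecture]` obligation nodes, nothing asserted; a row whose statement
IS a named Literature fact aliases it by name for table uniformity — no restatement, and
deliberately no provenance TAG on such alias `def`s, only prose references, so that the gate's
inline-cite relocation does not apply) — and, for EXCLUDED-IN-TREE rows, the one-liner
`theorem row_<key>_excluded : Row_<key> := <tree decl>`.  **Nothing in this file is a claim about
Navier–Stokes regularity; no summit statement is proved by this seat.**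

Objects.  Leray's backward ansatz `u(t,x) = (2a(T−t))^{-1/2} U(x/√(2a(T−t)))`, profile system
`IsLerayProfile ν a U P` (`−νΔU + aU + a(y·∇)U + (U·∇)U + ∇P = 0`, `div U = 0`, `a > 0`); discrete
self-similarity `IsDiscretelySelfSimilar c u` (`c u(c²t, cx) = u(t,x)`), rotated `IsRotatedDSS c R u`;
Type I decay `HasTypeIDecay C₀ u` (`‖u(t,x)‖ ≤ C₀/(‖x‖ + √(−t))`); ancient mild class
`IsAncientMildSolution 1 u` with measurable slices; the λ-DSS Liouville statement
`TypeIDSSLiouville c` and the leaf `SUM.TypeIDSSLiouvilleConjecture = ∀ c, TypeIDSSLiouville c ∧ ∀ R,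
RotatedTypeIDSSLiouville c R` (rotated part = block R, typer-2's `ScenarioCensusRotating`).

| key | cell | value / Lean |
|---|---|---|
| D1 | Type I · exact self-similar · profile `U ∈ L³` | EXCLUDED — `Row_D1 := necas_ruzicka_sverak` (Nečas–Růžička–Šverák 1996) |
| D2 | Type I · exact self-similar · `U ∈ L^q`, `3 < q < ∞` | EXCLUDED — `Row_D2 := tsai_selfsimilar` (Tsai 1998 Thm 1) |
| D3 | I∨II · exact self-similar · local energy class near the singularity | EXCLUDED — `Row_D3 := tsai_selfsimilar_local_energy` (Tsai 1998 Thm 2) |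
| D4 | Type I · exact self-similar · bounded profile (any symmetry) | EXCLUDED — `Row_D4 := tsai_selfsimilar_bounded` (bounded profiles are constant); barrier `BAR.LeraySelfSimilarBlowupExclusion` = D1 ∧ D2 ∧ D3 definitionally, discharged `BAR.LeraySelfSimilarBlowupExclusion_holds` |
| D5 | Type I · λ-DSS, `1 < λ < λ₁(C₀)` (fine ratio) | EXCLUDED — `Row_D5 := chaeWolf2017_removing_dss` (Chae–Wolf 2017 Thm 1.3); barrier `BAR.NearOneDssTypeIExclusion_holds` |
| D6 | Type I · any λ (indeed any ancient classical solution) · SMALL Type-I constant `C₀ ≤ ε₀` | EXCLUDED — `Row_D6` / `BAR.ancient_typeI_smallConstant_eq_zero` (Chae–Wolf 2017 Rem. 1.4); the quantitative windows `STH.rdssClass_empty_of_typeI_le_coulomb`, `…_of_typeI_le_seven_quarters`, `…_of_mixedConstant(_coulomb)`, `…_of_timeConstant_mul_spaceConstant`, `…_of_timeOnlyThreshold`, `…_of_explicitSpaceThreshold`, `…_of_gaussianSmallTypeI` (files `Theorems/DssFarFieldSlavingBlowupTypeIDssProfile*.lean`) import the route file `Theses.DssFarFieldSlaving` and are cited by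 name only (theses-cone lint) |
| D7 | Type I · λ-DSS, general λ > 1, large constant · ancient mild | OPEN-WITH-LINE — `Row_D7 := ∀ c, TypeIDSSLiouville c` (@[conjecture]); `row_D7_of_typeIDSSLiouvilleConjecture`; negative item ⟨0155⟩ `THS.DssFarFieldSlaving.BlowupTypeIDssProfile` = ¬leaf; deciders ⟨24077⟩, ⟨23843⟩, ⟨22508⟩ |
| D7a | λ-DSS in `C_t L^p`, `p ≥ 3` ⇒ Type I (class conversion) | context — fact `chaeWolf2017_dss_typeI_decay` (`_holds`), cited only |
| D7b | Type I · λ-DSS / RDSS · axisymmetric (any swirl) | EXCLUDED — `Row_D7b` / `rotatedTypeIDSSLiouville_of_isAxisymmetric` (KNSS Thm 5.3); class forms `STH.rdssClass_axisymmetric_empty`, `STH.rdssClass_aeAxisymmetric_empty` cited only |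
| D7c | Type I · λ-DSS / RDSS · discrete or structural side condition (reversing, m-fold, mirror-corotating, sign-coherent Gaussian, generalised Beltrami, tilted rigid rotation, (a.e.) self-similar, subcritical strain/certificate, cross-flow, Lamb direction, …) | EXCLUDED per sub-cell — `STH.rdssClass_*_empty / _ae_zero` family (same files; cited only) |
| D8 | Type II (any type) · λ-DSS with rough (unbounded) profile · local energy class | OPEN-NO-LINE — `Row_D8` (@[conjecture], appended): `c`-DSS + suitable weak in `Q((0,0),1)` (A–B Def. 2.1 class) ⇒ vertex regular; forward rough DSS EXIST (D10) |
| D9 | Type II · generalised / log-modulated self-similar | OPEN-NO-LINE except the asymptotically-self-similar exclusions F4b / F4b′ (block F); docstring only |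
| D10 | forward (expander) self-similar / DSS from homogeneous or DSS data | context: EXIST, smooth for `t > 0` — `bradshawTsai2019_dss_existence_holds`, `chaeWolf2018_dss_existence_holds`, `chae_wolf_dss_existence_holds` (not blow-up scenarios) |
| D11 | Euler (`ν = 0`) self-similar / DSS | context — `chaeShvydkoy2013_*_holds`, `chae2010_euler_typeI_threshold_holds` |

`STH.` = `Summit.NavierStokesRegularity.NavierStokesRegularity.Theorems.`, `THS.` = `….Theses.`,
`SUM.` = `Summit.NavierStokesRegularity.NavierStokesRegularity.`, `BAR.` = `Literature.Barriers.NavierStokesRegularity.`.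
-/

noncomputable section

-- the summit and its single problem share the name `NavierStokesRegularity` (D-0017 nested layout)
set_option linter.dupNamespace false

open Set Function Filter Topology MeasureTheory Metric
open scoped NNReal ENNReal ContDiff

namespace Summit.NavierStokesRegularity.NavierStokesRegularity.Theorems.ScenarioCensus

open Literature.Analysis Literature.Analysis.FluidPDE
open Literature.Barriers.NavierStokesRegularity

/-! ## D1–D4: Leray's exactly self-similar blow-up -/

/-- **Row D1** (Type I · exactly self-similar · profile `U ∈ L³(ℝ³)`): the profile vanishes —
ALIAS of the fact `necas_ruzicka_sverak` (Nečas–Růžička–Šverák, Acta Math. 176 (1996), Thm 1),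
PROVED in tree.  EXCLUDED-IN-TREE. (ref: NecasRuzickaSverak1996, Thm 1 (p. 291)) -/
def Row_D1 : Prop := necas_ruzicka_sverak

/-- Row D1 is a theorem of the tree. [cite: NecasRuzickaSverak1996, Thm 1 (p. 291)] -/
theorem row_D1_excluded : Row_D1 := necas_ruzicka_sverak_holds

/-- **Row D2** (Type I · exactly self-similar · `U ∈ L^q(ℝ³)`, `3 < q < ∞`): `U ≡ 0` — ALIAS of
`tsai_selfsimilar` (Tsai, ARMA 143 (1998), Thm 1), PROVED.  EXCLUDED-IN-TREE. (ref: Tsai1998, Thm 1) -/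
def Row_D2 : Prop := tsai_selfsimilar

/-- Row D2 is a theorem of the tree. [cite: Tsai1998, Thm 1] -/
theorem row_D2_excluded : Row_D2 := tsai_selfsimilar_holds

/-- **Row D3** (I∨II · exactly self-similar · local energy estimates near the putative singularity,
as every Leray–Hopf solution satisfies): `U ≡ 0` — ALIAS of `tsai_selfsimilar_local_energy`
(Tsai 1998, Thm 2), PROVED.  EXCLUDED-IN-TREE: no finite-energy first-time singularity is EXACTLY
self-similar. (ref: Tsai1998, Thm 2) -/
def Row_D3 : Prop := tsai_selfsimilar_local_energy

/-- Row D3 is a theorem of the tree. [cite: Tsai1998, Thm 2] -/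
theorem row_D3_excluded : Row_D3 := tsai_selfsimilar_local_energy_holds

/-- **Row D4** (Type I · exactly self-similar · bounded profile, any symmetry): bounded Leray
profiles are constant (Tsai 1998 Thm 1, `q = ∞`), so a Type-I exactly self-similar singularity (whose
profile is automatically bounded) is trivial — ALIAS of `tsai_selfsimilar_bounded`, PROVED.
EXCLUDED-IN-TREE. (ref: Tsai1998, Thm 1 (p. 31, q = ∞) and §5 (p. 48)) -/
def Row_D4 : Prop := tsai_selfsimilar_bounded

/-- Row D4 is a theorem of the tree. [cite: Tsai1998, Thm 1 (p. 31) and §5 (p. 48)] -/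
theorem row_D4_excluded : Row_D4 := tsai_selfsimilar_bounded_holds

/-! ## D5–D7: discretely self-similar (λ-DSS) Type-I profiles -/

/-- **Row D5** (Type I · λ-DSS with FINE ratio `1 < λ < λ₁(C₀)`): for every Type-I constant `C₀ > 0`
there is `λ₁ > 1` such that every classical λ-DSS solution on `ℝ³ × (−∞,0)` (`ν = 1`) with
`‖u‖ ≤ C₀/(‖x‖+√(−t))` and `1 < λ < λ₁` vanishes — ALIAS of `chaeWolf2017_removing_dss` (Chae–Wolf
2017 Thm 1.3 = Pineau–Vicol 2026 Thm 1.6), PROVED; barrier `NearOneDssTypeIExclusion_holds`.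
EXCLUDED-IN-TREE. (ref: ChaeWolf2017RemovingDSS, Thm 1.3 (arXiv:1610.09464 p. 3)) -/
def Row_D5 : Prop := chaeWolf2017_removing_dss

/-- Row D5 is a theorem of the tree. [cite: ChaeWolf2017RemovingDSS, Theorem 1.3 (arXiv:1610.09464 p. 3)] -/
theorem row_D5_excluded : Row_D5 := chaeWolf2017_removing_dss_holds

/-- **Row D6** (Type I · ANY ratio, indeed any ancient classical solution · SMALL Type-I constant):
there is an absolute `ε₀ > 0` such that every classical solution of Navier–Stokes (`ν = 1`) on
`ℝ³ × (−∞,0)` with `‖u(t,x)‖ ≤ C₀/(‖x‖+√(−t))`, `0 ≤ C₀ ≤ ε₀`, vanishes identically (Chae–Wolf 2017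
Rem. 1.4; tree: `Literature.Barriers.NavierStokesRegularity.ancient_typeI_smallConstant_eq_zero`).
EXCLUDED-IN-TREE.  The quantitative small-constant windows for the rotated-DSS profile class
(`STH.rdssClass_empty_of_typeI_le_coulomb` and its siblings) are cited in the module docstring only.
(ref: ChaeWolf2017RemovingDSS, Remark 1.4 (arXiv:1610.09464 p. 3)) -/
def Row_D6 : Prop :=
  ∃ ε₀ : ℝ, 0 < ε₀ ∧ ∀ {C₀ : ℝ} {u : ℝ → EuclideanSpace ℝ (Fin 3) → EuclideanSpace ℝ (Fin 3)}
    {p : ℝ → EuclideanSpace ℝ (Fin 3) → ℝ}, 0 ≤ C₀ → C₀ ≤ ε₀ →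
      IsClassicalNSSolutionOn (Iio 0) 1 0 u p → HasTypeIDecay C₀ u → ∀ t < 0, ∀ x, u t x = 0

/-- Row D6 is a theorem of the tree. [cite: ChaeWolf2017RemovingDSS, Remark 1.4 (arXiv:1610.09464 p. 3)] -/
theorem row_D6_excluded : Row_D6 := ancient_typeI_smallConstant_eq_zero

/-- **Row D7** (Type I · λ-DSS, GENERAL λ > 1, large constant · ancient mild class with measurable
slices): every λ-discretely self-similar ancient mild solution (`ν = 1`) with a Type-I bound vanishes
a.e. on every slice — `∀ c, TypeIDSSLiouville c`, the `R = 1` half of the conjecture leaf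
`SUM.TypeIDSSLiouvilleConjecture` (Bradshaw–Tsai 2017 Open Problem 5.1; Tsai 2018 Conj. 8.8–8.9).
OPEN-WITH-LINE (negative item ⟨0155⟩ `THS.DssFarFieldSlaving.BlowupTypeIDssProfile`; deciders ⟨24077⟩,
⟨23843⟩, ⟨22508⟩); known sub-cells D5, D6, D7b, D7c; LADDER N5/Z2 metered census «none found under
meter» is not an exclusion. [cite: BradshawTsai2017CPDE, §5 Open Problem 5.1] -/
@[conjecture] def Row_D7 : Prop := ∀ c : ℝ, TypeIDSSLiouville c

/-- Row D7 is the `R = 1` half of the leaf `TypeIDSSLiouvilleConjecture`. [cite: BradshawTsai2017CPDE, §5 Open Problem 5.1] -/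
theorem row_D7_of_typeIDSSLiouvilleConjecture
    (h : Summit.NavierStokesRegularity.NavierStokesRegularity.TypeIDSSLiouvilleConjecture) : Row_D7 :=
  fun c => (h c).1

/-- **Row D7b** (Type I · λ-DSS or rotated DSS, any factor `c` and any linear isometry `R` ·
AXISYMMETRIC slices, swirl allowed): such an ancient mild solution with measurable slices and a
Type-I bound vanishes a.e. on every slice — the statement of the tree theorem
`rotatedTypeIDSSLiouville_of_isAxisymmetric` (KNSS 2009 Thm 5.3 + Type-I decay; the DSS structure is
not even used).  EXCLUDED-IN-TREE (class forms `STH.rdssClass_axisymmetric_empty`,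
`STH.rdssClass_aeAxisymmetric_empty` cited only). (ref: KochNadirashviliSereginSverak2009, Thm 5.3 and §6) -/
def Row_D7b : Prop :=
  ∀ (c : ℝ) (R : EuclideanSpace ℝ (Fin 3) ≃ₗᵢ[ℝ] EuclideanSpace ℝ (Fin 3))
    (u : ℝ → EuclideanSpace ℝ (Fin 3) → EuclideanSpace ℝ (Fin 3)),
    IsAncientMildSolution 1 u → (∀ t < 0, AEStronglyMeasurable (u t) volume) →
    IsRotatedDSS c R u → (∃ C₀ : ℝ, HasTypeIDecay C₀ u) → (∀ t < 0, IsAxisymmetric (u t)) →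
    ∀ t < 0, u t =ᵐ[volume] 0

/-- Row D7b is a theorem of the tree. [cite: KochNadirashviliSereginSverak2009, Thm 5.3 and §6] -/
theorem row_D7b_excluded : Row_D7b := rotatedTypeIDSSLiouville_of_isAxisymmetric

/-! ## D8: discretely self-similar singularities in the local energy class (appended 2026-08-28) -/

/-- **Row D8** (Type II — indeed ANY type · backward λ-DSS · LOCAL ENERGY class, rough profile
allowed): for every factor `c > 1`, a `c`-discretely self-similar field `u` (`c u(c²t, cx) = u(t,x)`)
which, with some pressure `p`, is a suitable weak solution of Navier–Stokes (`ν = 1`) in the unit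
backward parabolic ball `Q((0,0),1)` in the local energy class of Albritton–Barker Def. 2.1
(`IsSuitableWeakSolutionInBall 1 (0,0) u p`: `esssup_t ∫_{B₁}|u|² < ∞`, `∇u ∈ L²(Q₁)`, `p ∈ L^{3/2}(Q₁)`,
local energy inequality) is NOT singular at the vertex `(0,0)` — the discretely self-similar
analogue of Tsai's local-energy theorem (row D3) with no Type-I hypothesis, i.e. the union of the
cells D7 (Type I, large constant) and D8 (rough profile, "Type-II DSS") of the census.  By discrete
self-similarity a vertex-regular backward DSS field is trivial on the backward paraboloid, so this is
a Liouville statement.  Known sub-cells: fine ratio + Type I (D5), small constant (D6), axisymmetric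
(D7b), `C_t L^p` profiles are Type I (D7a).  OPEN-NO-LINE ("such nonexistence result for the
nontrivial discretely self-similar solutions is still not available", Chae–Wolf 2017 §1; Bradshaw–Tsai
2017 Open Problem 5.1 is the Type-I sub-question). [cite: ChaeWolf2017RemovingDSS, §1 (arXiv:1610.09464 p. 2)] [cite: BradshawTsai2017CPDE, §5 Open Problem 5.1] -/
@[conjecture] def Row_D8 : Prop :=
  ∀ (c : ℝ), 1 < c →
    ∀ (u : ℝ → EuclideanSpace ℝ (Fin 3) → EuclideanSpace ℝ (Fin 3))
      (p : ℝ → EuclideanSpace ℝ (Fin 3) → ℝ),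
    IsDiscretelySelfSimilar c u →
    IsSuitableWeakSolutionInBall 1 ((0 : ℝ), (0 : EuclideanSpace ℝ (Fin 3))) u p →
    ¬ IsBackwardSingularPoint u ((0 : ℝ), (0 : EuclideanSpace ℝ (Fin 3)))

/-! ## D9a: Type-I asymptotically self-similar singularities, local form (Chae 2007 Thm 1.5;
appended 2026-08-28, census v1.8 row D9a / refuter finding H9) -/

/-- **Row D9a** (Type I · ASYMPTOTICALLY self-similar at the Leray scaling, locally near a point
`(z, T)` · Kato class `C([0,T); L^p)`, `p ≥ 3`): if the scaled local `L^q` deviation of `v` from the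
backward self-similar field with profile `V̄ ∈ L^p` on the shrinking balls `B(z, R√(T−t))` tends to
`0` as `t ↑ T` ((i) `q ≥ 3`, one `R > 0`, or (ii) `2 ≤ q < 3`, all `R > 0`), then `V̄ = 0` AND `v` is
Hölder continuous near `(z, T)` (no singularity there) — BY NAME the typed fact
`chae2007_asymptoticallySelfSimilar_local` (Chae, Math. Ann. 338 (2007), Thm 1.5), which has NO
`_holds` in the tree: it is proved CONDITIONALLY on the local Leray existence theorem
(`row_D9a_of_localLerayExistence`, Lemarié-Rieusset 2016 Thm 14.8 =
`localLeraySolution_exists_of_memE2`, undischarged), the profile half being unconditional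
(`Row_D9aP`, `row_D9aP_excluded`).  Value: EXCLUDED-IN-PRINT-NOT-TREE (conditional-in-tree).
(ref: Chae2007, Thm 1.5 (arXiv:math/0604234 pp. 4–5); LemarieRieusset2016, Thm 14.8) -/
def Row_D9a : Prop := chae2007_asymptoticallySelfSimilar_local

/-- Row D9a modulo the local Leray existence theorem (Lemarié-Rieusset 2016 Thm 14.8, the named fact
`localLeraySolution_exists_of_memE2`): the tree's conditional proof
`chae2007_asymptoticallySelfSimilar_local_of_localLerayExistence` (blow-up limit, NRŠ/Tsai for the
weak profile, Gustafson–Kang–Tsai ε-regularity — all proved — plus the suitable representative up to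
the blow-up time from the local Leray theory). [cite: Chae2007, Thm 1.5 (proof, arXiv pp. 7–8)] [cite: LemarieRieusset2016, Thm. 14.8] -/
theorem row_D9a_of_localLerayExistence (hE : localLeraySolution_exists_of_memE2) : Row_D9a :=
  chae2007_asymptoticallySelfSimilar_local_of_localLerayExistence hE

/-- **Row D9a, profile half** (Type I · asymptotically self-similar, local · the PROFILE vanishes):
under the hypotheses of row D9a (verbatim the binders of `chae2007_asymptoticallySelfSimilar_local`:
`T > 0`, `p ≥ 3`, `(v, π)` classical on `ℝ³ × (0,T)` with `v ∈ C([0,T); L^p)`, a point `z`,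
`V̄ ∈ L^p`, and Chae's disjunctive deviation hypothesis (i)/(ii)), the profile `V̄` is `0` a.e. — so a
first-time singularity cannot be asymptotically self-similar with a NONTRIVIAL `L^p` profile.  The
statement of the tree theorem `chae2007_profile_ae_eq_zero` (Nečas–Růžička–Šverák for `p = 3`, Tsai
for `p > 3`, applied to the blow-up limit; the continuity-in-`L^p` binder is not even used), after
Chae's normal form `forall_tendsto_chaeLocalDeviation_of_hyp`.  EXCLUDED-IN-TREE (the regularity
half of D9a — Hölder continuity at `(z,T)` once `V̄ = 0` — is the conditional part).
(ref: Chae2007, Thm 1.5, first conclusion, and its proof (arXiv p. 8)) -/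
def Row_D9aP : Prop :=
  ∀ (T : ℝ), 0 < T → ∀ (p : ℝ≥0), 3 ≤ p →
    ∀ (v : ℝ → EuclideanSpace ℝ (Fin 3) → EuclideanSpace ℝ (Fin 3))
      (π : ℝ → EuclideanSpace ℝ (Fin 3) → ℝ),
    IsClassicalNSSolutionOn (Ioo 0 T) 1 0 v π → ContinuousInLpOn (Ico 0 T) p v →
    ∀ (z : EuclideanSpace ℝ (Fin 3)) (V : EuclideanSpace ℝ (Fin 3) → EuclideanSpace ℝ (Fin 3)),
    MemLp V (p : ℝ≥0∞) volume → ∀ (q : ℝ≥0),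
    ((3 ≤ q ∧ ∃ R : ℝ, 0 < R ∧ Tendsto (chaeLocalDeviation T z q R v V) (𝓝[<] T) (𝓝 0)) ∨
      (2 ≤ q ∧ q < 3 ∧
        ∀ R : ℝ, 0 < R → Tendsto (chaeLocalDeviation T z q R v V) (𝓝[<] T) (𝓝 0))) →
    V =ᵐ[volume] 0

/-- Row D9a's profile half is a theorem of the tree (`chae2007_profile_ae_eq_zero` with
`forall_tendsto_chaeLocalDeviation_of_hyp`). [cite: Chae2007, Thm 1.5 (first conclusion; proof arXiv p. 8)] -/
theorem row_D9aP_excluded : Row_D9aP := by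
  intro T hT p hp v π hv _ z V hV q hq
  obtain ⟨hq2, hall⟩ := forall_tendsto_chaeLocalDeviation_of_hyp hq
  exact chae2007_profile_ae_eq_zero hT hp hv z hV hq2 hall

/-- Row D9a yields its profile half (first conjunct of the fact's conclusion). [cite: Chae2007, Thm 1.5] -/
theorem row_D9aP_of_row_D9a (h : Row_D9a) : Row_D9aP :=
  fun _ hT _ hp _ _ hv hvc z _ hV _ hq => (h hT hp hv hvc z hV hq).1

/-! ## D9a in the Leray–Hopf frame: Chae 2007 Thm 1.5 is UNCONDITIONAL for classical
Leray–Hopf solutions (appended 2026-08-28, census v1.8 row D9a) -/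

/-- **Row D9a, Leray–Hopf frame** (Type I · asymptotically self-similar at the Leray scaling,
locally near `(z, T)` · the census's forward class: a CLASSICAL solution on `ℝ³ × [0, T)`, `ν = 1`,
which is Leray–Hopf from its datum — e.g. every Clay-class solution after the viscosity rescaling):
let `T > 0`, `(u, p)` classical on `[0,T)` with `IsLerayHopfOn T 1 0 (u 0) u`, a point `z`, a
profile `V̄ ∈ L^s(ℝ³)` for some `s ≥ 3`, and Chae's disjunctive deviation hypothesis ((i) `q ≥ 3`
and the scaled local `L^q` deviation of `u` from the backward self-similar field with profile `V̄`
on `B(z, R√(T−t))` tends to `0` for ONE `R > 0`, or (ii) `2 ≤ q < 3` and for ALL `R > 0`).  Then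
`V̄ = 0` a.e. AND `u` is Hölder continuous on a parabolic cylinder `(T − r², T) × B(z, r)` — both
conclusions of Chae 2007 Thm 1.5, with NO local-Leray-existence input: in this frame the solution
itself, with its gauged pressure, is a suitable weak solution in every parabolic ball at the vertex
`(T, z)` (`SereginSverak2002.isSuitableWeakSolutionInBall_vertex`), which is exactly the
representative `h₂` that the Kato-class fact `Row_D9a` still owes to Lemarié-Rieusset's Thm 14.8.
Proof: profile half `chae2007_profile_ae_eq_zero`; then the deviation from the ZERO profile tends to
`0`, the scaled `L^∞_t L^q_x` smallness passes to small `C + D` at one radius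
(`exists_ae_eLpNorm_le_of_tendsto_chaeLocalDeviation_zero`,
`exists_cknC_add_cknD_lt_of_ae_eLpNorm_small_of_two_le`), and the ε-regularity endgame
`chae_exists_eps_holder_of_suitableInBall` (Gustafson–Kang–Tsai / CKN) gives Hölder continuity.
The continuity-in-`L^p` binder of the Kato class is not needed.  EXCLUDED-IN-TREE
(`row_D9aLH_excluded`): in the census's forward frame the cell D9a is closed in tree; the
Kato-class (infinite-energy `L^p` data) version `Row_D9a` remains conditional.
(ref: Chae2007, Thm 1.5 (arXiv:math/0604234 pp. 4–5, proof pp. 7–8); GustafsonKangTsai2007, Thm 1.1) -/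
def Row_D9aLH : Prop :=
  ∀ (T : ℝ), 0 < T →
    ∀ (u : ℝ → EuclideanSpace ℝ (Fin 3) → EuclideanSpace ℝ (Fin 3))
      (p : ℝ → EuclideanSpace ℝ (Fin 3) → ℝ),
    IsClassicalNSSolutionOn (Ico 0 T) 1 0 u p → IsLerayHopfOn T 1 0 (u 0) u →
    ∀ (z : EuclideanSpace ℝ (Fin 3)) (s : ℝ≥0), 3 ≤ s →
    ∀ (V : EuclideanSpace ℝ (Fin 3) → EuclideanSpace ℝ (Fin 3)), MemLp V (s : ℝ≥0∞) volume →
    ∀ (q : ℝ≥0),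
    ((3 ≤ q ∧ ∃ R : ℝ, 0 < R ∧ Tendsto (chaeLocalDeviation T z q R u V) (𝓝[<] T) (𝓝 0)) ∨
      (2 ≤ q ∧ q < 3 ∧
        ∀ R : ℝ, 0 < R → Tendsto (chaeLocalDeviation T z q R u V) (𝓝[<] T) (𝓝 0))) →
    V =ᵐ[volume] 0 ∧
      ∃ r > 0, ∃ C α : ℝ≥0, 0 < α ∧ HolderOnWith C α (uncurry u) (parabolicCylinder r (T, z))

/-- Row D9a in the Leray–Hopf frame is a theorem of the tree (Chae 2007 Thm 1.5, both conclusions,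
for classical Leray–Hopf solutions; the seventh/eighth Chae companions plus the vertex suitability of
Seregin–Šverák 2002). [cite: Chae2007, Thm 1.5 (arXiv pp. 4–5; proof pp. 7–8)] -/
theorem row_D9aLH_excluded : Row_D9aLH := by
  intro T hT u p hsol hLH z s hs V hV q hq
  have hv : IsClassicalNSSolutionOn (Ioo 0 T) 1 0 u p :=
    hsol.mono Ioo_subset_Ico_self (uniqueDiffOn_Ioo 0 T)
  obtain ⟨hq2, hall⟩ := forall_tendsto_chaeLocalDeviation_of_hyp hq
  have hV0 : V =ᵐ[volume] 0 := chae2007_profile_ae_eq_zero hT hs hv z hV hq2 hall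
  refine ⟨hV0, ?_⟩
  have hall0 : ∀ R : ℝ, 0 < R → Tendsto (chaeLocalDeviation T z q R u 0) (𝓝[<] T) (𝓝 0) := by
    intro R hR
    refine (hall R hR).congr fun t => ?_
    exact chaeLocalDeviation_congr_ae hV0 t
  obtain ⟨ε₀, hε₀, H⟩ := chae_exists_eps_holder_of_suitableInBall hv z
  -- the solution itself, with the gauged pressure, is suitable in `Q((T, z), √T)`
  set ρ : ℝ := Real.sqrt T with hρdef
  have hρ : 0 < ρ := Real.sqrt_pos.2 hT
  have hρT : ρ ^ 2 ≤ T := by rw [hρdef, Real.sq_sqrt hT.le]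
  have hIB := SereginSverak2002.isSuitableWeakSolutionInBall_vertex hT hsol hLH z hρT
  set P : ℝ → EuclideanSpace ℝ (Fin 3) → ℝ :=
    fun t x => p t x - (p t 0 - normalisedPressure (u t) 0) with hPdef
  have huv : uncurry u =ᵐ[volume.restrict (parabolicCylinder ρ (T, z))] uncurry u :=
    Filter.EventuallyEq.rfl
  have hS : ∀ η : ℝ, 0 < η → ∃ r₁ : ℝ, 0 < r₁ ∧ r₁ ≤ ρ ∧ ∀ r : ℝ, 0 < r → r ≤ r₁ →
      ∀ᵐ t ∂(volume.restrict (Ioo ((T, z).1 - r ^ 2) (T, z).1)),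
        eLpNorm (u t) (q : ℝ≥0∞) (volume.restrict (ball (T, z).2 r)) *
          ENNReal.ofReal (r ^ (((q : ℝ) - 3) / q)) ≤ ENNReal.ofReal η := fun η hη =>
    exists_ae_eLpNorm_le_of_tendsto_chaeLocalDeviation_zero hρ (hall0 1 one_pos) huv hη
  obtain ⟨r₀, hr₀, hr₀ρ, hsmall⟩ :=
    exists_cknC_add_cknD_lt_of_ae_eLpNorm_small_of_two_le hIB hq2 hS hε₀
  exact H r₀ hr₀ (by nlinarith) u P (hIB.of_le_radius hr₀ hr₀ρ)
    (ae_restrict_of_ae_restrict_of_subset (parabolicCylinder_mono hr₀.le hr₀ρ (T, z)) huv) hsmall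

/-! ## D8n: near-one DSS ratio at fixed local-energy budget (appended 2026-08-28, census v1.47 row D8n;
ns-idea-2 LINE «rough-ratio», `RoughRatio.Row_D8n` VERBATIM) -/

/-- **Row D8n** (Type II allowed — rough profile; Type-I members too · `λ`-DSS with factor `c` NEAR ONE at
FIXED local-energy budget · no symmetry · suitable weak solutions in the unit backward parabolic cylinder
`Q₁(0,0)`): for every budget `G` there is `c₀ = c₀(G) > 1` such that a backward `c`-DSS field, `1 < c < c₀`,
which with some pressure is a suitable weak solution in `Q₁(0,0)` (`IsSuitableWeakSolutionInBall 1 (0,0) u p`)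
with `‖u‖_{L³(Q₁)} ≤ G` and `‖p‖_{L^{3/2}(Q₁)} ≤ G`, is NOT singular at the vertex `(0,0)` (small `G` is CKN
ε-regularity, so the content is large `G`).  VERBATIM the line decl `Lines.RoughRatio.Row_D8n` of ns-idea-2's
«rough-ratio» (`pub/ideators/ns-idea-2/lines/rough-ratio/line-rough-ratio.lean`, sha16 c3a4d87febac0840 :114).
Sub-cell of `Row_D8` (`row_D8n_of_row_D8`, `c₀ = 2`).  OPEN-NO-LINE (files-only line); NOT in print — the
nearest printed near-one DSS exclusions (Chae–Wolf 2017 Thm 1.3, Pineau–Vicol 2026 Thm 1.9 = row D5) need the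
pointwise Type-I envelope and smoothness (arXiv:1610.09464 p. 3), which this cell trades for a critical Lebesgue
budget. -/
@[conjecture] def Row_D8n : Prop :=
  ∀ G : ℝ≥0, ∃ c₀ : ℝ, 1 < c₀ ∧ ∀ c ∈ Set.Ioo (1 : ℝ) c₀,
    ∀ (u : ℝ → EuclideanSpace ℝ (Fin 3) → EuclideanSpace ℝ (Fin 3))
      (p : ℝ → EuclideanSpace ℝ (Fin 3) → ℝ),
      IsDiscretelySelfSimilar c u →
      IsSuitableWeakSolutionInBall 1 (0 : ℝ × EuclideanSpace ℝ (Fin 3)) u p →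
      eLpNorm (uncurry u) 3
          (volume.restrict (parabolicCylinder 1 (0 : ℝ × EuclideanSpace ℝ (Fin 3)))) ≤ G →
      eLpNorm (uncurry p) (3 / 2)
          (volume.restrict (parabolicCylinder 1 (0 : ℝ × EuclideanSpace ℝ (Fin 3)))) ≤ G →
      ¬ IsBackwardSingularPoint u (0 : ℝ × EuclideanSpace ℝ (Fin 3))

/-- Lattice (the line's bridge `row_D8n_of_row_D8`, kernel-checked there with `c₀ = 2`): the census row D8
(all ratios `c > 1`, no budget) gives the sub-row D8n. -/
theorem row_D8n_of_row_D8 (h : Row_D8) : Row_D8n := by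
  intro G
  refine ⟨2, by norm_num, ?_⟩
  intro c hc u p hdss hsuit _ _
  exact h c hc.1 u p hdss hsuit

end Summit.NavierStokesRegularity.NavierStokesRegularity.Theorems.ScenarioCensus

end
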